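import Summits.CriticalPhenomena.Ising3DConformalLimit.Theorems.PerfectScreeningScreeningUpgrade
import HarnessLib

/-!
# Route `PerfectScreening`: the screening dichotomy `ScreeningDichotomy` (stmt-CriticalPhenomena-1348)

THEOREM-ONLY file (no definitions, no named facts). Closes the support item
`Summit.CriticalPhenomena.Ising3DConformalLimit.Theses.PerfectScreening.ScreeningDichotomy`:

  `GreenAsymptotics → SubH → (∃ c > 0, ∀ x ≠ 0, c/‖x‖ ≤ G x) ∨ (‖x‖ G x → 0 cofinitely)`,

`G = criticalTwoPoint 3 = ⟨σ₀σ_x⟩⁺_{β_c(3)}`, as the case split on non-saturation foreseen by the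
route: if `NonSat` (`liminf_n n G(n e₁) = 0`) holds, the tree theorem `screeningUpgrade_proof`
(`PerfectScreeningScreeningUpgrade.lean`, item 1346: exterior maximum principle under `SubH`) gives
perfect screening `‖x‖ G(x) → 0`; if it fails, `n G(n e₁) ≥ ε > 0` for all large `n`, and the
Messager–Miracle-Solé comparison in the sup norm (`twoPointPlus_le_of_mul_supNorm_le`:
`G y ≤ G v` whenever `‖y‖_∞ ≥ 3‖v‖_∞`, Aizenman–Duminil-Copin 2021 eq. (5.3)) turns this axial
bound into the pointwise Coulomb bound `c/‖v‖ ≤ G v` for every `v ≠ 0`.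

(A second, self-contained proof by lattice potential theory — Riesz decomposition
`G = G₀ ∗ μ₀ - G₀ ∗ ν` off a finite exceptional set, which also yields `ScreeningDichotomyEventual` —
is landed separately as the `PerfectScreeningScreeningDichotomy{Green,GreenSums,Riesz,…}` helpers.)

References: A. Messager, S. Miracle-Solé, J. Stat. Phys. 17 (1977) 245–262; G. C. Hegerfeldt,
Comm. Math. Phys. 57 (1977) 259–266; M. Aizenman, H. Duminil-Copin, Ann. of Math. 194 (2021), §5.1
eq. (5.3).
-/

noncomputable section

namespace Summit.CriticalPhenomena.Ising3DConformalLimit.Theorems.PerfectScreening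

open Literature.Probability.LatticeModels Filter Finset
open scoped Topology

/-- The sup norm of the axis point `n e₁ ∈ ℤ³` is `n`. [folklore] -/
theorem supNorm_single_natCast (n : ℕ) : Site.supNorm (Pi.single 0 (n : ℤ) : Site 3) = n := by
  have h : ((Site.supNorm (Pi.single 0 (n : ℤ) : Site 3) : ℕ) : ℝ) = n := by
    rw [← Site.norm_eq_supNorm, Pi.norm_single, Int.norm_eq_abs]
    push_cast
    exact abs_of_nonneg (Nat.cast_nonneg n)
  exact_mod_cast h

/-- **From an eventual axial lower bound to a pointwise Coulomb bound** (Messager–Miracle-Solé):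
if `ε ≤ n · G(n e₁)` for all `n ≥ N₀`, then `c/‖v‖ ≤ G v` for every `v ≠ 0`, with
`c = ε/(3 max(1,N₀))`. For `‖v‖_∞ = m` take `n = max (3m) N₀`: `‖n e₁‖_∞ = n ≥ 3‖v‖_∞`, so
`G(n e₁) ≤ G v` (Aizenman–Duminil-Copin 2021 (5.3)), while `n ≤ 3 m max(1,N₀)`. [folklore] -/
theorem coulomb_of_eventually_axis {ε : ℝ} (hε : 0 < ε) {N₀ : ℕ}
    (h : ∀ n : ℕ, N₀ ≤ n → ε ≤ (n : ℝ) * criticalTwoPoint 3 (Pi.single 0 (n : ℤ))) :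
    ∃ c : ℝ, 0 < c ∧ ∀ v : Site 3, v ≠ 0 → c / ‖v‖ ≤ criticalTwoPoint 3 v := by
  set N₁ := max 1 N₀ with hN₁
  have hN₁1 : (1 : ℝ) ≤ N₁ := by exact_mod_cast le_max_left 1 N₀
  refine ⟨ε / (3 * N₁), by positivity, fun v hv => ?_⟩
  set m := Site.supNorm v with hm
  have hm1 : 1 ≤ m := Nat.one_le_iff_ne_zero.2 fun h0 => hv (Site.supNorm_eq_zero_iff.1 h0)
  set n := max (3 * m) N₀ with hn
  have hn0 : N₀ ≤ n := le_max_right _ _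
  have hn3 : 3 * m ≤ n := le_max_left _ _
  have hnle : (n : ℝ) ≤ 3 * m * N₁ := by
    have h1 : n ≤ 3 * m * N₁ := by
      rcases le_total (3 * m) N₀ with h2 | h2
      · rw [hn, max_eq_right h2]
        calc N₀ ≤ N₁ := le_max_right _ _
          _ ≤ 3 * m * N₁ := Nat.le_mul_of_pos_left N₁ (by omega)
      · rw [hn, max_eq_left h2]
        exact Nat.le_mul_of_pos_right _ (le_max_left 1 N₀)
    exact_mod_cast h1
  -- Messager–Miracle-Solé: the axis point at sup-distance `n ≥ 3‖v‖_∞` is dominated by `v`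
  have hdom : criticalTwoPoint 3 (Pi.single 0 (n : ℤ)) ≤ criticalTwoPoint 3 v :=
    twoPointPlus_le_of_mul_supNorm_le (criticalBeta_nonneg 3) (by rw [supNorm_single_natCast]; omega)
  have h1 : ε ≤ (n : ℝ) * criticalTwoPoint 3 v :=
    (h n hn0).trans (mul_le_mul_of_nonneg_left hdom (Nat.cast_nonneg n))
  have hGv : 0 ≤ criticalTwoPoint 3 v := twoPointPlus_nonneg_of_gks (criticalBeta_nonneg 3) v
  have hm0 : (0 : ℝ) < m := by exact_mod_cast hm1
  have hnorm : ‖v‖ = (m : ℝ) := by rw [Site.norm_eq_supNorm]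
  rw [hnorm, div_le_iff₀ hm0]
  have h2 : ε ≤ 3 * m * N₁ * criticalTwoPoint 3 v := h1.trans (by nlinarith)
  calc ε / (3 * N₁) ≤ (3 * m * N₁ * criticalTwoPoint 3 v) / (3 * N₁) := by gcongr
    _ = criticalTwoPoint 3 v * m := by field_simp

/-- **The screening dichotomy** (item `stmt-CriticalPhenomena-1348`, exact signature): granting the
`a/|x|` asymptotics of the Green function of the graph Laplacian of `ℤ³` and lattice-subharmonicity
of `G = ⟨σ₀σ_x⟩⁺_{β_c(3)}` off the origin, EITHER `c/‖x‖ ≤ G(x)` for all `x ≠ 0` (Coulomb) OR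
`‖x‖G(x) → 0` (perfect screening). Case split on non-saturation `liminf_n n G(n e₁) = 0`:
`screeningUpgrade_proof` in one case, Messager–Miracle-Solé (`coulomb_of_eventually_axis`) in the
other. [folklore] -/
theorem screeningDichotomy_proof :
    Summit.CriticalPhenomena.Ising3DConformalLimit.Theses.PerfectScreening.ScreeningDichotomy := by
  unfold Summit.CriticalPhenomena.Ising3DConformalLimit.Theses.PerfectScreening.ScreeningDichotomy
  intro hGA hSubH
  by_cases hNS : ∀ ε : ℝ, 0 < ε →
      ∃ᶠ n : ℕ in Filter.atTop, (n : ℝ) * criticalTwoPoint 3 (Pi.single 0 (n : ℤ)) < ε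
  · right
    exact screeningUpgrade_proof hGA hSubH hNS
  · left
    push Not at hNS
    obtain ⟨ε, hε, hev⟩ := hNS
    obtain ⟨N₀, hN₀⟩ := Filter.eventually_atTop.1 hev
    exact coulomb_of_eventually_axis hε hN₀

end Summit.CriticalPhenomena.Ising3DConformalLimit.Theorems.PerfectScreening
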